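/-
Copyright (c) 2026. All rights reserved.
Released under Apache 2.0 license as described in the file LICENSE.
-/
import Literature.Probability.FitznerVanDerHofstad2017.NobleBoundsNTargets
import HarnessLib

/-!
# The regular target family with the bare-indicator (β′) entry at the cell `(a₀, a′, c) = (1, ≥2, ≥2)`

CITATION HEADER (PLACEMENT v11). Part of a certified REPRODUCTION of R. Fitzner, R. van der Hofstad,
*Mean-field behavior for nearest-neighbor percolation in `d > 10`*, EJP 22 (2017) no. 43 [FvdH17]
(arXiv:1506.07977v2), App. B Table `B^{(2),ι,a,b}` row `a = 1`, column `b ≥ 2`, sub-row `d_{C̃}(w,u) ≥ 2`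
(p. 76), and §6.1 (6.4) (p. 58); notebook `Percolation.nb` cell [71] `Bound[B2i,1,2,s]` second summand
(K-branch of cell [49]).  Origin: build `lace`, node X2-kit K2 (β′): the target family, the pointwise block and `hT`
typed by carver-g24, the block summation / translation invariance / `★`-section part and the filing by lean1-g18
(`HOME/lean1-g16/K2-DESIGN-MEMO.md` §3; `HOME/num2/engineB/g27/K2B-PRICE-B.md`: price 0 at d = 11, engine B); its
packages are `NobleBoundsNMidK2B.nonempty_jPkg_midE_K2B_lit` / `nonempty_jPkg_firstE_K2B_lit`.

WHAT.  `tgtRegB` = the landed `NobleBlocks.tgtReg` with its single entry `v = (true, 2)`, `a₀ = 1`, `a′ = 2`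
(the typed-row JOINT form `p⁻¹ · T · 𝓟`, reachable only with the `useUW` kit) replaced by the PRODUCT form
`tgtK2B = 2dD(w−u) · T_{1,1,2}(u′−t, z−t, 0) · T_{1,0,1̲}(w′−t, e−t, −t) · τ_{≥0}(z−w)` (all points relative to
`u`), i.e. the bound obtained by NOT insisting that the exit bond `{u, w}` and the line `w → z` be bond-disjoint
from the 2-chain `w′ ← e ← u` jointly (BK applied to the two groups separately).  Unfolding lemmas show
`tgtRegB = tgtReg` at every other entry, so a dispatcher over `tgtRegB` re-uses every landed cell theorem.

SCOPE.  Definitions, `rfl`/`if_neg` lemmas, the sum identity and the `hT` inequalities (`sum_tgtRegB_le_blockBFullptB'`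
and its filtered / first-junction forms); then the SUMMED (β′) block `blockBFullB' L X₂ := blockB' L (blockBNTB' L) X₂`
(`blockBNTB'` = the block summation `Σ_{t,z}` of `blockBNTptB'`, via its base-`0` table), the summation identity
`Σ_{t,z} blockBFullptB' L X = blockBFullB' L X₂` (`hBpt`), translation invariance of both, and the agreement of the
(β′) families with the landed ones off the cell `(a, a′) = (1, 2)` — in particular of all three `★` SECTIONS
(`secEcpt/secEopt/secEocpt`, `secEc/secEo/secEoc` at exit class `0` / entry class `2`), so that only the regular
block `starB`'s first argument changes downstream.  No measure statement; any `d`, any letter bundle `L`.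

[cite: FitznerVanDerHofstad2017, App. B Table "B^{(2),ι,a,b}" row a = 1, b ≥ 2, d_{C̃}(w,u) ≥ 2 (arXiv:1506.07977v2 p. 76); §6.1 (6.4) (p. 58); §4.2 (4.7)–(4.8), Def. 4.1 (pp. 34–36)]
-/

noncomputable section

open scoped ENNReal

namespace Literature.Probability.FitznerVanDerHofstad2017.NobleBlocks

open Literature.Probability.LatticeModels Literature.Probability.Percolation
open scoped BigOperators ENNReal

variable {d : ℕ}

/-- **The (β′) product-form entry** of App. B row `(1, ≥2 | d_{C̃}(w,u) ≥ 2)` in the chain's slot order at base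
point `u`: `2dD(w−u) · T_{1,1,2}((u′−u)−(t−u), (z−u)−(t−u), 0) · T_{1,0,1̲}((w′−u)−(t−u), e_κ−(t−u), −(t−u)) ·
τ_{≥0}((z−u)−(w−u))`. [cite: FitznerVanDerHofstad2017, App. B Table "B^{(2),ι,a,b}" row a = 1, b ≥ 2, d_{C̃}(w,u) ≥ 2, with the pentagon split by BK (arXiv:1506.07977v2 p. 76); §4.2 (4.8) (p. 34)] -/
def tgtK2B (L : Letters d) (κ : Fin d × Bool) (u w t z w' u' : Site d) : ℝ≥0∞ :=
  twoDD (w - u) * L.T (.ge 1) (.ge 1) (.ge 2) ((u' - u) - (t - u)) ((z - u) - (t - u)) 0 *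
    L.T (.ge 1) (.ge 0) (.eq 1) ((w' - u) - (t - u)) (stepVec κ - (t - u)) (-(t - u)) *
      L.tau (.ge 0) ((z - u) - (w - u))

/-- **The regular target family, (β′) variant**: `tgtReg` with the entry `(v, a₀, a′) = ((true,2), 1, 2)` replaced
by `tgtK2B`. [cite: FitznerVanDerHofstad2017, §5.1 (5.4) (arXiv:1506.07977v2 p. 48); §6.1 (6.4) (p. 58); App. B (p. 76)] -/
def tgtRegB (L : Letters d) (κ : Fin d × Bool) (a₀ a' : Fin 3) (u w t z w' u' : Site d) (v : Bool × Fin 3) :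
    ℝ≥0∞ :=
  if v = (true, 2) ∧ a₀ = 1 ∧ a' = 2 then tgtK2B L κ u w t z w' u' else tgtReg L κ a₀ a' u w t z w' u' v

section Unfold

variable (L : Letters d) (κ : Fin d × Bool) (a₀ a' : Fin 3) (u w t z w' u' : Site d)

/-- Off the K2 cell the two families agree. [cite: FitznerVanDerHofstad2017, §5.1 (5.4) (arXiv:1506.07977v2 p. 48)] -/
theorem tgtRegB_of_not {v : Bool × Fin 3} (h : ¬ (v = (true, 2) ∧ a₀ = 1 ∧ a' = 2)) :
    tgtRegB L κ a₀ a' u w t z w' u' v = tgtReg L κ a₀ a' u w t z w' u' v := if_neg h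

/-- The K2 entry. [cite: FitznerVanDerHofstad2017, App. B Table "B^{(2),ι,a,b}" row a = 1, b ≥ 2, d_{C̃}(w,u) ≥ 2 (arXiv:1506.07977v2 p. 76)] -/
theorem tgtRegB_K2 : tgtRegB L κ 1 2 u w t z w' u' (true, 2) = tgtK2B L κ u w t z w' u' :=
  if_pos ⟨rfl, rfl, rfl⟩

/-- `F‴` entries unchanged. [cite: FitznerVanDerHofstad2017, §5.1 (5.4) first summand (arXiv:1506.07977v2 p. 48)] -/
theorem tgtRegB_false (c : Fin 3) :
    tgtRegB L κ a₀ a' u w t z w' u' (false, c) = blockAiotaSt' L κ a₀ c u w t z * blockA L c a' t z w' u' := by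
  rw [tgtRegB_of_not L κ a₀ a' u w t z w' u' (fun h => by simpa using congrArg Prod.fst h.1), tgtReg_false]

/-- `F′`/cut-through entry unchanged. [cite: FitznerVanDerHofstad2017, §5.1 (5.4) second summand (arXiv:1506.07977v2 p. 48)] -/
theorem tgtRegB_true_zero :
    tgtRegB L κ a₀ a' u w t z w' u' (true, 0) =
      kd z t * (blockAiota' L κ a₀ a' u w w' t * blockPS L 0 (u' - t) (u' - t)) := by
  rw [tgtRegB_of_not L κ a₀ a' u w t z w' u' (fun h => by simpa using congrArg Prod.snd h.1), tgtReg_true_zero]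

/-- `c = 1` entries unchanged. [cite: FitznerVanDerHofstad2017, App. B columns d_{C̃}(w,u) = 1 (arXiv:1506.07977v2 p. 76)] -/
theorem tgtRegB_true_one : tgtRegB L κ a₀ a' u w t z w' u' (true, 1) = blockBNTpt'₁ L κ a₀ a' u w t z w' u' := by
  rw [tgtRegB_of_not L κ a₀ a' u w t z w' u' (fun h => by simpa using congrArg Prod.snd h.1), tgtReg_true_one]

/-- `c = 2` entries off `(a₀, a′) = (1, 2)` unchanged. [cite: FitznerVanDerHofstad2017, App. B columns d_{C̃}(w,u) ≥ 2 (arXiv:1506.07977v2 p. 76)] -/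
theorem tgtRegB_true_two_of_ne (h : a₀ ≠ 1 ∨ a' ≠ 2) :
    tgtRegB L κ a₀ a' u w t z w' u' (true, 2) = blockBNTpt'₂ L κ a₀ a' u w t z w' u' := by
  rw [tgtRegB_of_not L κ a₀ a' u w t z w' u' (fun h' => h.elim (fun h1 => h1 h'.2.1) fun h2 => h2 h'.2.2),
    tgtReg_true_two]

/-- The (β′) family vanishes at exit class `a′ ≤ 1` on the `F″`-proper kinds, like `tgtReg`.
[cite: FitznerVanDerHofstad2017, App. B Table "B^{(2),ι,a,b}", "b ≥ 2" (arXiv:1506.07977v2 p. 76)] -/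
theorem tgtRegB_true_of_val_le_one {a' : Fin 3} (ha' : a'.val ≤ 1) {c : Fin 3} (hc : c ≠ 0) :
    tgtRegB L κ a₀ a' u w t z w' u' (true, c) = 0 := by
  rw [tgtRegB_of_not L κ a₀ a' u w t z w' u' (fun h => by have := h.2.2; subst this; simp at ha'),
    tgtReg_true_of_val_le_one L κ a₀ u w t z w' u' ha' hc]

end Unfold

/-! ### The pointwise `B^{(2)}` piece and the primed middle block with the (β′) entry; `hT` -/

/-- **The base-`u` `B^{(2)}` pointwise piece, (β′) variant**: `B^{(2)}_{pt,1} + (β′ entry at (a, a′) = (1, 2), else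
B^{(2)}_{pt,2})`. [cite: FitznerVanDerHofstad2017, App. B Table "B^{(2),ι,a,b}(0,v,x,y)" (arXiv:1506.07977v2 p. 76); §5.1 (5.4) (p. 48)] -/
def blockBNTptB' (L : Letters d) : DirBlockFamilyPt d := fun κ a a' u w t z w' u' =>
  blockBNTpt'₁ L κ a a' u w t z w' u' +
    (if a = 1 ∧ a' = 2 then tgtK2B L κ u w t z w' u' else blockBNTpt'₂ L κ a a' u w t z w' u')

/-- **`B'^{ι,a,b}` pointwise with the (β′) `B^{(2)}` piece plugged in** (extra summand `X`).
[cite: FitznerVanDerHofstad2017, §5.1 (5.4) (arXiv:1506.07977v2 p. 48); App. B (p. 76)] -/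
def blockBFullptB' (L : Letters d) (X : DirBlockFamilyPt d) : DirBlockFamilyPt d := blockBpt' L (blockBNTptB' L) X

section Sum

variable (L : Letters d) (κ : Fin d × Bool) (a₀ a' : Fin 3) (u w t z w' u' : Site d)

/-- Off `(a, a′) = (1, 2)` the (β′) piece is the landed one. [cite: FitznerVanDerHofstad2017, App. B (arXiv:1506.07977v2 p. 76)] -/
theorem blockBNTptB'_of_ne (h : a₀ ≠ 1 ∨ a' ≠ 2) :
    blockBNTptB' L κ a₀ a' u w t z w' u' = blockBNTpt' L κ a₀ a' u w t z w' u' := by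
  have h' : ¬ (a₀ = 1 ∧ a' = 2) := fun h'' => h.elim (fun h1 => h1 h''.1) fun h2 => h2 h''.2
  simp only [blockBNTptB', if_neg h', blockBNTpt'_eq_add]

/-- **THE SUM IDENTITY, (β′) variant.** [cite: FitznerVanDerHofstad2017, §5.1 (5.4) (arXiv:1506.07977v2 p. 48); §6.1 (6.4) (p. 58)] -/
theorem sum_tgtRegB_eq :
    ∑ v, tgtRegB L κ a₀ a' u w t z w' u' v =
      (∑ c : Fin 3, blockAiotaSt' L κ a₀ c u w t z * blockA L c a' t z w' u')
        + kd z t * (blockAiota' L κ a₀ a' u w w' t * blockPS L 0 (u' - t) (u' - t))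
        + blockBNTptB' L κ a₀ a' u w t z w' u' := by
  simp only [Fintype.sum_prod_type, Fintype.sum_bool, Fin.sum_univ_three, tgtRegB_false, tgtRegB_true_zero,
    tgtRegB_true_one, blockBNTptB']
  by_cases h : a₀ = 1 ∧ a' = 2
  · obtain ⟨h1, h2⟩ := h
    subst h1; subst h2
    rw [tgtRegB_K2, if_pos ⟨rfl, rfl⟩]
    ring
  · rw [tgtRegB_true_two_of_ne L κ a₀ a' u w t z w' u' (not_and_or.mp h), if_neg h]
    ring

/-- **`hT` for regular class pairs, (β′) variant.** [cite: FitznerVanDerHofstad2017, §5.1 (5.4) (arXiv:1506.07977v2 p. 48); §6.1 (6.4) (p. 58)] -/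
theorem sum_tgtRegB_le_blockBFullptB' (X : DirBlockFamilyPt d) :
    ∑ v, tgtRegB L κ a₀ a' u w t z w' u' v ≤ blockBFullptB' L X κ a₀ a' u w t z w' u' := by
  rw [sum_tgtRegB_eq]
  exact le_self_add

/-- `hT` over any sub-family of variants, (β′) variant. [cite: FitznerVanDerHofstad2017, §5.1 (5.4) (arXiv:1506.07977v2 p. 48); §6.1 (6.4) (p. 58)] -/
theorem sum_filter_tgtRegB_le_blockBFullptB' (X : DirBlockFamilyPt d) (P : Bool × Fin 3 → Prop) [DecidablePred P] :
    ∑ v ∈ Finset.univ.filter P, tgtRegB L κ a₀ a' u w t z w' u' v ≤ blockBFullptB' L X κ a₀ a' u w t z w' u' :=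
  (Finset.sum_le_sum_of_subset (Finset.filter_subset _ _)).trans
    (sum_tgtRegB_le_blockBFullptB' L κ a₀ a' u w t z w' u' X)

/-- `hT` at the FIRST junction, (β′) variant. [cite: FitznerVanDerHofstad2017, §6.1 (6.4)–(6.10) (arXiv:1506.07977v2 pp. 58–59); §5.1 (5.4) (p. 48)] -/
theorem sum_filter_blockPS_mul_tgtRegB_le (X : DirBlockFamilyPt d) (P : Bool × Fin 3 → Prop) [DecidablePred P]
    (S : ℝ≥0∞) :
    ∑ v ∈ Finset.univ.filter P, S * tgtRegB L κ a₀ a' u w t z w' u' v ≤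
      S * blockBFullptB' L X κ a₀ a' u w t z w' u' := by
  rw [← Finset.mul_sum]
  exact mul_le_mul' le_rfl (sum_filter_tgtRegB_le_blockBFullptB' L κ a₀ a' u w t z w' u' X P)

end Sum

/-! ### The summed (β′) block, block summation, translation invariance, agreement off the cell `(1, 2)` -/

/-- **The base-`0` table of the summed (β′) `B^{(2)}` piece**: `Σ_{t,z} blockBNTptB' L ι a b 0 v t z x y`.
[cite: FitznerVanDerHofstad2017, App. B Table "B^{(2),ι,a,b}(0,v,x,y)", heading "Σ_{u,w}" (arXiv:1506.07977v2 p. 76); §5.1 (5.4) (p. 48)] -/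
def blockBNTB₀' (L : Letters d) (ι : Fin d × Bool) (a b : Fin 3) (v x y : Site d) : ℝ≥0∞ :=
  ∑' t, ∑' z, blockBNTptB' L ι a b 0 v t z x y

/-- **The summed (β′) `B^{(2)}` piece at a general base point** (by translation of its base-`0` table).
[cite: FitznerVanDerHofstad2017, App. B Table "B^{(2),ι,a,b}(0,v,x,y)" (arXiv:1506.07977v2 p. 76); §5.1 (5.4) (p. 48)] -/
def blockBNTB' (L : Letters d) : DirBlockFamily d := fun ι a b => ofBase (blockBNTB₀' L ι a b)

/-- **`B'^{ι,a,b}` with the summed (β′) `B^{(2)}` piece plugged in** (extra summand `X₂`).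
[cite: FitznerVanDerHofstad2017, §5.1 (5.4) (arXiv:1506.07977v2 p. 48); App. B (p. 76)] -/
def blockBFullB' (L : Letters d) (X₂ : DirBlockFamily d) : DirBlockFamily d := blockB' L (blockBNTB' L) X₂

section Summation

open Literature.Probability.FitznerVanDerHofstad2017.BlockSummation

variable (L : Letters d)

/-- The (β′) pointwise `B^{(2)}` piece is translation invariant in all six vertices (every argument of its letters is
a difference of vertices). [cite: FitznerVanDerHofstad2017, §5.1 (5.4) and "Elements of the bounds" (arXiv:1506.07977v2 pp. 48–49); §3.5 (p. 32)] -/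
theorem isTransInv₆_blockBNTptB' (κ : Fin d × Bool) (a a' : Fin 3) : IsTransInv₆ (blockBNTptB' L κ a a') :=
  fun g u w t z x y => by
    simp only [blockBNTptB', blockBNTpt'₁, blockBNTpt'₂, tgtK2B, add_sub_add_right_eq_sub]

/-- **Block summation of the (β′) pointwise piece**: `Σ_{t,z} blockBNTptB' L κ a a' u w t z w' u' = blockBNTB' L κ a a' u w w' u'`.
[cite: FitznerVanDerHofstad2017, App. B Table "B^{(2),ι,a,b}(0,v,x,y)", heading "Σ_{u,w}" (arXiv:1506.07977v2 p. 76); §5.1 (5.4) (p. 48)] -/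
theorem tsum_tsum_blockBNTptB' (κ : Fin d × Bool) (a a' : Fin 3) (u w w' u' : Site d) :
    ∑' t, ∑' z, blockBNTptB' L κ a a' u w t z w' u' = blockBNTB' L κ a a' u w w' u' := by
  have h : ∀ t z, blockBNTptB' L κ a a' u w t z w' u' =
      blockBNTptB' L κ a a' 0 (w - u) (t - u) (z - u) (w' - u) (u' - u) := fun t z => by
    have h' := isTransInv₆_blockBNTptB' L κ a a' (-u) u w t z w' u'
    simp only [← sub_eq_add_neg, sub_self] at h'
    exact h'.symm
  simp_rw [h]
  rw [show blockBNTB' L κ a a' u w w' u' = ∑' t, ∑' z, blockBNTptB' L κ a a' 0 (w - u) t z (w' - u) (u' - u)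
    from rfl]
  have h2 : ∀ t, ∑' z, blockBNTptB' L κ a a' 0 (w - u) (t - u) (z - u) (w' - u) (u' - u) =
      ∑' z, blockBNTptB' L κ a a' 0 (w - u) (t - u) z (w' - u) (u' - u) := fun t =>
    tsum_sub_right_eq (fun z => blockBNTptB' L κ a a' 0 (w - u) (t - u) z (w' - u) (u' - u)) u
  simp_rw [h2]
  exact tsum_sub_right_eq (fun t => ∑' z, blockBNTptB' L κ a a' 0 (w - u) t z (w' - u) (u' - u)) u

/-- **`Σ_{t,z} blockBFullptB' L X = blockBFullB' L X₂`** when `Σ_{t,z} X = X₂`.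
[cite: FitznerVanDerHofstad2017, §5.1 (5.4) (arXiv:1506.07977v2 p. 48); App. B (p. 76)] -/
theorem tsum_tsum_blockBFullptB' (X : DirBlockFamilyPt d) (X₂ : DirBlockFamily d)
    (hX : ∀ κ a a' u w w' u', ∑' t, ∑' z, X κ a a' u w t z w' u' = X₂ κ a a' u w w' u')
    (κ : Fin d × Bool) (a a' : Fin 3) (u w w' u' : Site d) :
    ∑' t, ∑' z, blockBFullptB' L X κ a a' u w t z w' u' = blockBFullB' L X₂ κ a a' u w w' u' :=
  tsum_tsum_blockBpt' L (blockBNTptB' L) X (blockBNTB' L) X₂ (tsum_tsum_blockBNTptB' L) hX κ a a' u w w' u'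

/-- **The block-summation hypothesis `hBpt` for the (β′) pair** `B := blockBFullB' L X₂`, `Bpt := blockBFullptB' L X`.
[cite: FitznerVanDerHofstad2017, §5.1 (5.4) (arXiv:1506.07977v2 p. 48); §6.2.1 (6.49)–(6.51) (pp. 65–67)] -/
theorem blockBFullptB'_hBpt (X : DirBlockFamilyPt d) (X₂ : DirBlockFamily d)
    (hX : ∀ κ a a' u w w' u', ∑' t, ∑' z, X κ a a' u w t z w' u' = X₂ κ a a' u w w' u') :
    ∀ κ a a' (u w w' u' : Site d),
      ∑' t, ∑' z, blockBFullptB' L X κ a a' u w t z w' u' ≤ blockBFullB' L X₂ κ a a' u w w' u' :=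
  fun κ a a' u w w' u' => (tsum_tsum_blockBFullptB' L X X₂ hX κ a a' u w w' u').le

/-- `blockBFullptB' L X` is translation invariant in all six vertices whenever `X` is.
[cite: FitznerVanDerHofstad2017, §5.1 (5.4) and "Elements of the bounds" (arXiv:1506.07977v2 pp. 48–49); §3.5 (p. 32)] -/
theorem isTransInv₆_blockBFullptB' {X : DirBlockFamilyPt d} (hX : ∀ κ a a', IsTransInv₆ (X κ a a'))
    (κ : Fin d × Bool) (a a' : Fin 3) : IsTransInv₆ (blockBFullptB' L X κ a a') :=
  isTransInv₆_blockBpt' L (isTransInv₆_blockBNTptB' L) hX κ a a'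

/-- The summed (β′) `B^{(2)}` piece is translation invariant.
[cite: FitznerVanDerHofstad2017, §5.1 (5.4) and "Elements of the bounds" (arXiv:1506.07977v2 pp. 48–49); §3.5 (p. 32)] -/
theorem isTransInv_blockBNTB' (ι : Fin d × Bool) (a b : Fin 3) : IsTransInv (blockBNTB' L ι a b) :=
  isTransInv_ofBase _

/-- `blockBFullB' L X₂` is translation invariant whenever `X₂` is.
[cite: FitznerVanDerHofstad2017, §5.1 (5.4) and "Elements of the bounds" (arXiv:1506.07977v2 pp. 48–49); §3.5 (p. 32)] -/
theorem isTransInv_blockBFullB' {X₂ : DirBlockFamily d} (hX₂ : ∀ ι a b, IsTransInv (X₂ ι a b)) (ι : Fin d × Bool)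
    (a b : Fin 3) : IsTransInv (blockBFullB' L X₂ ι a b) :=
  isTransInv_blockB' L (fun ι a b => isTransInv_blockBNTB' L ι a b) hX₂ ι a b

/-- Off `(a, a′) = (1, 2)` the (β′) pointwise primed block is the landed one.
[cite: FitznerVanDerHofstad2017, §5.1 (5.4) (arXiv:1506.07977v2 p. 48); App. B (p. 76)] -/
theorem blockBFullptB'_of_ne (X : DirBlockFamilyPt d) (κ : Fin d × Bool) {a₀ a' : Fin 3} (h : a₀ ≠ 1 ∨ a' ≠ 2)
    (u w t z w' u' : Site d) :
    blockBFullptB' L X κ a₀ a' u w t z w' u' = blockBFullpt' L X κ a₀ a' u w t z w' u' := by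
  simp only [blockBFullptB', blockBFullpt', blockBpt', blockBNTptB'_of_ne L κ a₀ a' u w t z w' u' h]

/-- Off `(a, b) = (1, 2)` the summed (β′) `B^{(2)}` piece is the landed primed table.
[cite: FitznerVanDerHofstad2017, App. B Table "B^{(2),ι,a,b}(0,v,x,y)" (arXiv:1506.07977v2 p. 76)] -/
theorem blockBNTB'_of_ne (ι : Fin d × Bool) {a b : Fin 3} (h : a ≠ 1 ∨ b ≠ 2) (u v x y : Site d) :
    blockBNTB' L ι a b u v x y = blockBNT' L ι a b u v x y := by
  rw [← tsum_tsum_blockBNTptB', ← tsum_tsum_blockBNTpt']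
  simp only [blockBNTptB'_of_ne L ι a b _ _ _ _ _ _ h]

/-- Off `(a, b) = (1, 2)` the summed (β′) block is the landed primed block.
[cite: FitznerVanDerHofstad2017, §5.1 (5.4) (arXiv:1506.07977v2 p. 48); App. B (p. 76)] -/
theorem blockBFullB'_of_ne (X₂ : DirBlockFamily d) (ι : Fin d × Bool) {a b : Fin 3} (h : a ≠ 1 ∨ b ≠ 2)
    (u v x y : Site d) : blockBFullB' L X₂ ι a b u v x y = blockBFull' L X₂ ι a b u v x y := by
  simp only [blockBFullB', blockBFull', blockB', blockBNTB'_of_ne L ι h]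

/-- At `(a, b) = (1, 2)` the summed (β′) `B^{(2)}` piece is `Σ_{t,z}` of the `c = 1` row plus the product-form entry.
[cite: FitznerVanDerHofstad2017, App. B Table "B^{(2),ι,a,b}(0,v,x,y)" row a = 1, b ≥ 2 (arXiv:1506.07977v2 p. 76)] -/
theorem blockBNTB'_one_two (ι : Fin d × Bool) (u v x y : Site d) :
    blockBNTB' L ι 1 2 u v x y = ∑' t, ∑' z, (blockBNTpt'₁ L ι 1 2 u v t z x y + tgtK2B L ι u v t z x y) := by
  rw [← tsum_tsum_blockBNTptB']
  simp only [blockBNTptB', and_self, if_true]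

/-- The `★` SECTIONS of the (β′) pointwise block are those of the landed one: closed section (exit class `0`).
[cite: FitznerVanDerHofstad2017, §5.1 (5.4) (arXiv:1506.07977v2 p. 48); §6.2.1 (6.49) (p. 65)] -/
theorem secEcpt_blockBFullptB' (X : DirBlockFamilyPt d) :
    secEcpt (blockBFullptB' L X) 0 = secEcpt (blockBFullpt' L X) 0 := by
  funext κ a u w t z u'
  exact blockBFullptB'_of_ne L X κ (Or.inr (by decide)) u w t z u' u'

/-- Pinned section (entry class `2`). [cite: FitznerVanDerHofstad2017, §5.1 (5.4) (arXiv:1506.07977v2 p. 48); §6.2.1 (6.49) (p. 65)] -/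
theorem secEopt_blockBFullptB' (X : DirBlockFamilyPt d) :
    secEopt (blockBFullptB' L X) 2 = secEopt (blockBFullpt' L X) 2 := by
  funext κ a' u w t z w' u'
  unfold secEopt
  rw [blockBFullptB'_of_ne L X κ (Or.inl (show (2 : Fin 3) ≠ 1 by decide)) u w t z w' u']

/-- Pinned-and-closed section. [cite: FitznerVanDerHofstad2017, §5.1 (5.4) (arXiv:1506.07977v2 p. 48); §6.2.1 (6.49) (p. 65)] -/
theorem secEocpt_blockBFullptB' (X : DirBlockFamilyPt d) :
    secEocpt (blockBFullptB' L X) 2 0 = secEocpt (blockBFullpt' L X) 2 0 := by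
  funext κ u w t z u'
  unfold secEocpt
  rw [blockBFullptB'_of_ne L X κ (Or.inl (show (2 : Fin 3) ≠ 1 by decide)) u w t z u' u']

/-- Summed closed section. [cite: FitznerVanDerHofstad2017, §5.1 (5.4) (arXiv:1506.07977v2 p. 48); §6.2.1 (6.49)–(6.51) (pp. 65–67)] -/
theorem secEc_blockBFullptB' (X : DirBlockFamilyPt d) :
    secEc (blockBFullptB' L X) 0 = secEc (blockBFullpt' L X) 0 := by
  funext κ a u w u'
  unfold secEc
  simp only [blockBFullptB'_of_ne L X κ (Or.inr (show (0 : Fin 3) ≠ 2 by decide))]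

/-- Summed pinned section. [cite: FitznerVanDerHofstad2017, §5.1 (5.4) (arXiv:1506.07977v2 p. 48); §6.2.1 (6.49)–(6.51) (pp. 65–67)] -/
theorem secEo_blockBFullptB' (X : DirBlockFamilyPt d) :
    secEo (blockBFullptB' L X) 2 = secEo (blockBFullpt' L X) 2 := by
  funext κ a' u w w' u'
  unfold secEo
  simp only [blockBFullptB'_of_ne L X κ (Or.inl (show (2 : Fin 3) ≠ 1 by decide))]

/-- Summed pinned-and-closed section. [cite: FitznerVanDerHofstad2017, §5.1 (5.4) (arXiv:1506.07977v2 p. 48); §6.2.1 (6.49)–(6.51) (pp. 65–67)] -/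
theorem secEoc_blockBFullptB' (X : DirBlockFamilyPt d) :
    secEoc (blockBFullptB' L X) 2 0 = secEoc (blockBFullpt' L X) 2 0 := by
  funext κ u w u'
  unfold secEoc
  simp only [blockBFullptB'_of_ne L X κ (Or.inl (show (2 : Fin 3) ≠ 1 by decide))]

/-- **The section-choice extended pointwise family of the (β′) block** has the landed `★` entries.
[cite: FitznerVanDerHofstad2017, §5.1 (5.4) (arXiv:1506.07977v2 p. 48); §6.2.1 (6.49) (p. 65)] -/
theorem secStarBpt_blockBFullptB' (X : DirBlockFamilyPt d) :
    secStarBpt (blockBFullptB' L X) 2 0 =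
      starBpt (blockBFullptB' L X) (secEcpt (blockBFullpt' L X) 0) (secEopt (blockBFullpt' L X) 2)
        (secEocpt (blockBFullpt' L X) 2 0) := by
  rw [secStarBpt, secEcpt_blockBFullptB', secEopt_blockBFullptB', secEocpt_blockBFullptB']

/-- **`hBpt` for the (β′) section-choice pair with the landed `★` families**:
`Σ_{t,z} secStarBpt (blockBFullptB' L X) 2 0 ≤ starB (blockBFullB' L X₂) (secEc (blockBFullpt' L X) 0) (secEo … 2) (secEoc … 2 0)`.
[cite: FitznerVanDerHofstad2017, §5.1 (5.4) (arXiv:1506.07977v2 p. 48); §6.2.1 (6.49)–(6.51) (pp. 65–67)] -/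
theorem secStarBpt_blockBFullptB'_hBpt (X : DirBlockFamilyPt d) (X₂ : DirBlockFamily d)
    (hX : ∀ κ a a' u w w' u', ∑' t, ∑' z, X κ a a' u w t z w' u' = X₂ κ a a' u w w' u') :
    ∀ κ x y (u w w' u' : Site d), ∑' t, ∑' z, secStarBpt (blockBFullptB' L X) 2 0 κ x y u w t z w' u' ≤
      starB (blockBFullB' L X₂) (secEc (blockBFullpt' L X) 0) (secEo (blockBFullpt' L X) 2)
        (secEoc (blockBFullpt' L X) 2 0) κ x y u w w' u' := by
  have h := secStarBpt_hBpt (blockBFullptB' L X) (blockBFullptB'_hBpt L X X₂ hX) 2 0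
  rw [secEc_blockBFullptB', secEo_blockBFullptB', secEoc_blockBFullptB'] at h
  exact h

end Summation

end Literature.Probability.FitznerVanDerHofstad2017.NobleBlocks

end
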